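import Literature.NumberTheory.Automorphic.PureTensorWhittakerOnBox
import Literature.NumberTheory.Automorphic.IdeleUnitBoxSplitting
import Literature.NumberTheory.Automorphic.TorusSecondCoordinateIntegral
import Literature.NumberTheory.Automorphic.ArchKirillovFunctionGL2
import Literature.NumberTheory.Automorphic.GlobalHeckeTheoryGL2OfCenterInvariant
import Literature.NumberTheory.Automorphic.MixedSpaceUnitsMellinProduct
import HarnessLib

/-!
# The Hecke integrand `W_φ(diag(a, 1)) |a|^{s-1/2}` of a pure tensor cusp form of `GL₂` on the box of
# ideles integral off `S`, and its integral there (Jacquet–Langlands (1970), (11.1.2), p. 171)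

Topic `NumberTheory/Automorphic`; namespace `Literature.NumberTheory.Automorphic`. Theorems only (no
definition, no named fact, no instance).

Let `Π ≤ L²_cusp(GL₂ / K)` be cuspidal with archimedean component `τ`, finite component `π_f = M`
factorised along Flath (`j : ⊗'_v (V_v, x₀_v) → M`, local Whittaker functionals `λ_v`, unit vectors `e_v`,
product formula for `Λ₀` — the data of `exists_finWhittaker_prod_formula`), `ℓ_∞` the archimedean Whittaker
functional of the line `Φ_ℓ(T) = Λ₀(T) • ℓ_∞`, and `φ = invQuot (contRep (ĵ(x) e))` the cusp form of the pure
tensor `e ⊗ j(x)` (`PureTensorCuspForm`). For a finite set `S` of finite places containing the places where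
`x_v ≠ x₀_v` or `x₀_v` is not spherical, and an idele `a` that is a unit off `S` (`a ∈ ideleUnitBox {w | w ∉ S}`,
the box `B(Sᶜ) = K_∞ˣ × ∏_{v ∈ S} K_vˣ × ∏_{v ∉ S} 𝒪_vˣ`):

* `whittakerDepth_zero_pureTensor_diag_of_mem_ideleUnitBox` — **the Whittaker function at `diag(a, 1)`**:

    `W_φ(diag(a,1)) = Λ₀(j(e_S)) · (∏_{v ∈ S} λ_v(ρ_v(diag(a_v,1)) x_v)) · ξ(a_∞)`,

  `ξ(u) = ℓ_∞(τ(diag(u,1)) e) = kirillovFn hτ ℓ_∞ e u` the Kirillov function of `e` (`ArchKirillovFunctionGL2`),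
  `a_v = finComp v a ∈ K_vˣ`, `a_∞ = archUnitsOfIdele a ∈ K_∞ˣ` (`whittakerDepth_zero_pureTensor_glDiagonal`
  of `PureTensorWhittakerOnBox` at `b = (a, 1)`);
* `ideleNorm_eq_norm_mul_prod_of_mem_ideleUnitBox` — **the idele norm on the box**:
  `|a| = N(a_∞) · ∏_{v ∈ S} |a_v|_v`;
* `heckeIntegrand_pureTensor_of_mem_ideleUnitBox` — hence the Hecke integrand factorises on the box:

    `W_φ(diag(a,1)) |a|^{s-1/2} = Λ₀(j(e_S)) · (ξ(a_∞) N(a_∞)^{s-1/2}) · ∏_{v ∈ S} λ_v(ρ_v(diag(a_v,1)) x_v) |a_v|_v^{s-1/2}`;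

* `setIntegral_ideleUnitBox_heckeIntegrand_pureTensor` — **MAIN**: for measures `ν` on `𝕀_K`, `μ_∞` on `K_∞ˣ`,
  `μ_v` on `K_vˣ` and a constant `c` splitting `ν|_{B(Sᶜ)}` on product integrands (the conclusion of
  `exists_setIntegral_ideleUnitBox_compl_prod_eq_mul_prod`, `IdeleUnitBoxSplitting`, for `ν` left-invariant and
  finite on compacts and Haar `μ_∞`, `μ_v`; `c ≠ 0` when `ν` charges open sets), for every `s` at which the
  archimedean integrand `ξ N^{s-1/2}` and the local integrands `λ_v(ρ_v(diag(·,1)) x_v) |·|_v^{s-1/2}`, `v ∈ S`,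
  are integrable, the Hecke integrand is integrable on `B(Sᶜ)` and

    `∫_{B(Sᶜ)} W_φ(diag(a,1)) |a|^{s-1/2} dν(a)
       = c · Λ₀(j(e_S)) · (∫_{K_∞ˣ} ξ(u) N(u)^{s-1/2} dμ_∞) · ∏_{v ∈ S} ∫_{K_vˣ} λ_v(ρ_v(diag(y,1)) x_v) |y|_v^{s-1/2} dμ_v`

  — the `S`-part of the Euler factorisation (11.1.2) of the global Hecke integral
  `∫_{Kˣ\𝕀_K} φ(diag(a,1)) |a|^{s-1/2} dˣa = ∫_{𝕀_K} W_φ(diag(a,1)) |a|^{s-1/2} dˣa` of Jacquet–Langlands (1970),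
  p. 171 ("`Ψ(s, φ) = ∏_v Ψ(s, W_v)`"), with HONEST local integrals at the places of `S` (the contributions of
  the places outside `S` — the unramified Euler factors — come from the translates of the box, as in
  `RankinSelbergTorusEulerLimit`).

## References

* H. Jacquet, R. P. Langlands, *Automorphic Forms on GL(2)*, LNM 114 (1970), §11, (11.1.2) and p. 171
  [JacquetLanglands1970].
* J. W. Cogdell, *Lectures on L-functions, converse theorems, and functoriality for GL_n* (2004), §2.3, proof of
  Thm. 2.2 ("`Ψ(s; W_φ, W'_{φ'}) = ∏_v Ψ_v(s; W_v, W'_v)`") [CogdellAnalyticTheory2004].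
* J. Tate, *Fourier analysis in number fields and Hecke's zeta-functions* (1967), §4.3 (integration over the
  `S`-ideles) [CasselsFrohlichANT1967].
-/

noncomputable section

open MeasureTheory Measure NumberField NumberField.mixedEmbedding IsDedekindDomain Set Filter
open Literature.NumberTheory.GaloisRepresentations (ideleGroup unitIdeles localUnits)
open Literature.NumberTheory.GaloisRepresentations.IsNonarchimedeanLocalField (normAbs)
open scoped MatrixGroups InnerProductSpace Classical NNReal

namespace Literature.NumberTheory.Automorphic

variable {K : Type} [Field K] [NumberField K]

/-! ### 1. The torus point `diag(a, 1)` of an idele and the idele norm on the box -/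

section Torus

/-- `(a, 1)_v = (a_v, 1)`: the local diagonal of `b = (a, 1)` is `diag(a_v, 1)`. [folklore] -/
theorem glDiagonal_finComp_vecCons_one (a : ideleGroup K) (v : HeightOneSpectrum (𝓞 K)) :
    (glDiagonal 2 (v.adicCompletion K) fun i =>
        (GaloisRepresentations.ideleGroup.finComp (K := K) v).toHomUnits (![a, 1] i)) =
      diagGL2 ((GaloisRepresentations.ideleGroup.finComp (K := K) v).toHomUnits a) 1 := by
  unfold diagGL2
  congr 1
  funext i
  fin_cases i
  · rfl
  · change (GaloisRepresentations.ideleGroup.finComp (K := K) v).toHomUnits 1 = 1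
    exact map_one _

/-- `(a, 1)_∞ = (a_∞, 1)`: the archimedean diagonal of `b = (a, 1)` is `diag(a_∞, 1)`. [folklore] -/
theorem glDiagonal_archTorusOfIdele_vecCons_one (a : ideleGroup K) :
    glDiagonal 2 (mixedSpace K) (archTorusOfIdele 2 K ![a, 1]) = diagGL2 (archUnitsOfIdele K a) 1 := by
  unfold diagGL2
  congr 1
  funext i
  fin_cases i
  · rfl
  · change archUnitsOfIdele K 1 = 1
    exact map_one _

/-- An idele in the box `B(Sᶜ)` gives a pair `(a, 1)` that is a unit off `S`. [folklore] -/
theorem valued_vecCons_one_eq_one_of_mem_ideleUnitBox {S : Finset (HeightOneSpectrum (𝓞 K))} {a : ideleGroup K}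
    (ha : a ∈ ideleUnitBox (K := K) {w | w ∉ S}) :
    ∀ v ∉ S, ∀ i : Fin 2, Valued.v (((![a, 1] i : ideleGroup K) : AdeleRing (𝓞 K) K).2 v) = 1 := by
  intro v hv i
  fin_cases i
  · exact ha v hv
  · change Valued.v ((1 : FiniteAdeleRing (𝓞 K) K) v) = 1
    rw [show (1 : FiniteAdeleRing (𝓞 K) K) v = 1 from rfl, map_one]

/-- Mathlib's norm of the `v`-component of an idele is `|a_v|_v` (`normAbs`). [folklore] -/
theorem norm_snd_apply_eq_normAbs_finComp (a : ideleGroup K) (v : HeightOneSpectrum (𝓞 K)) :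
    ‖((a : ideleGroup K) : AdeleRing (𝓞 K) K).2 v‖ =
      ((normAbs (v.adicCompletion K)
        (((GaloisRepresentations.ideleGroup.finComp (K := K) v).toHomUnits a : (v.adicCompletion K)ˣ) :
          v.adicCompletion K) : ℝ≥0) : ℝ) :=
  norm_eq_coe_normAbs v _

/-- **The idele norm on the box `B(Sᶜ)`**: `|a| = N(a_∞) · ∏_{v ∈ S} |a_v|_v` for `a` a unit off `S` (the
finite part of the product formula for `|a|` has all its factors outside `S` equal to `1`).
[cite: CasselsFrohlichANT1967, Ch. XV §4.3] -/
theorem ideleNorm_eq_norm_mul_prod_of_mem_ideleUnitBox {S : Finset (HeightOneSpectrum (𝓞 K))} {a : ideleGroup K}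
    (ha : a ∈ ideleUnitBox (K := K) {w | w ∉ S}) :
    (IdeleClassGroup.ideleNorm K a : ℝ) =
      mixedEmbedding.norm ((archUnitsOfIdele K a : (mixedSpace K)ˣ) : mixedSpace K) *
        ∏ v ∈ S, ((normAbs (v.adicCompletion K)
          (((GaloisRepresentations.ideleGroup.finComp (K := K) v).toHomUnits a : (v.adicCompletion K)ˣ) :
            v.adicCompletion K) : ℝ≥0) : ℝ) := by
  rw [coe_ideleNorm, GaloisRepresentations.ideleNorm, coe_archUnitsOfIdele, mixedEmbedding_norm_ringEquiv_mixedSpace]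
  congr 1
  have hsupp : (Function.mulSupport fun v : HeightOneSpectrum (𝓞 K) => ‖((a : ideleGroup K) : AdeleRing (𝓞 K) K).2 v‖) ⊆
      (S : Set (HeightOneSpectrum (𝓞 K))) := by
    intro v hv
    by_contra hvS
    exact hv (norm_adicCompletion_eq_one_iff.mpr (ha v hvS))
  rw [finprod_eq_prod_of_mulSupport_subset _ hsupp]
  exact Finset.prod_congr rfl fun v _ => norm_snd_apply_eq_normAbs_finComp a v

/-- **`|a|^{s} = N(a_∞)^{s} · ∏_{v ∈ S} |a_v|_v^{s}`** on the box `B(Sᶜ)`. [folklore] -/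
theorem ideleNorm_cpow_eq_of_mem_ideleUnitBox {S : Finset (HeightOneSpectrum (𝓞 K))} {a : ideleGroup K}
    (ha : a ∈ ideleUnitBox (K := K) {w | w ∉ S}) (s : ℂ) :
    ((IdeleClassGroup.ideleNorm K a : ℝ) : ℂ) ^ s =
      ((mixedEmbedding.norm ((archUnitsOfIdele K a : (mixedSpace K)ˣ) : mixedSpace K) : ℝ) : ℂ) ^ s *
        ∏ v ∈ S, ((((normAbs (v.adicCompletion K)
          (((GaloisRepresentations.ideleGroup.finComp (K := K) v).toHomUnits a : (v.adicCompletion K)ˣ) :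
            v.adicCompletion K) : ℝ≥0) : ℝ) : ℂ) ^ s) := by
  rw [ideleNorm_eq_norm_mul_prod_of_mem_ideleUnitBox ha, Complex.ofReal_mul,
    Complex.mul_cpow_ofReal_nonneg (mixedEmbedding.norm_nonneg _)
      (Finset.prod_nonneg fun v _ => NNReal.coe_nonneg _),
    ofReal_prod_cpow S _ (fun v _ => NNReal.coe_nonneg _) s]

end Torus

/-! ### 2. The Whittaker function and the Hecke integrand of a pure tensor on the box -/

section Box

variable {μ : Measure (AdelicGroupData.gl 2 K).automorphicQuotient}
  [(AdelicGroupData.gl 2 K).IsAutomorphicMeasure μ]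

-- the house Borel structures on `GL₂(𝔸_K)` (as in `PureTensorCuspForm`)
attribute [local instance] adelicBorel borelSpace_adelic locallyCompactSpace_adelic
  secondCountableTopology_gl_adelic glAdeleBorel borelSpace_glAdele

set_option backward.isDefEq.respectTransparency false

variable {hcpt : isCompact_glFiniteIntegralLevel 2 K}
  {E : Type*} [NormedAddCommGroup E] [InnerProductSpace ℂ E] [CompleteSpace E]
  {τ : ContRepresentation ℂ (AutomorphyDatum.gl 2 K hcpt).arch.carrier E}
  {V : HeightOneSpectrum (𝓞 K) → Type*} [∀ v, AddCommGroup (V v)] [∀ v, Module ℂ (V v)]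

/-- **The Whittaker function of a pure tensor cusp form of `GL₂` at `diag(a, 1)`, `a` a unit off `S`**:

  `W_φ(diag(a,1)) = Λ₀(j(e_S)) · (∏_{v ∈ S} λ_v(ρ_v(diag(a_v,1)) x_v)) · kirillovFn ℓ_∞ e (a_∞)`

(`whittakerDepth_zero_pureTensor_glDiagonal` at `b = (a, 1)`; Jacquet–Langlands (1970), p. 171: the
factorisation of `W_φ(diag(a,1))` over the places). [cite: JacquetLanglands1970, §11 p. 171]
[cite: CogdellAnalyticTheory2004, §2.3] -/
theorem whittakerDepth_zero_pureTensor_diag_of_mem_ideleUnitBox (P : CuspidalAutomorphicRepGL 2 K μ)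
    (hτ : τ.IsStronglyContinuous) (ν₀ : Measure ↥(adelicUnipotent 2 K)) [IsHaarMeasure ν₀]
    {T₀ : multiplicityModule hcpt τ P.1} {Λ₀ : multiplicityModule hcpt τ P.1 →ₗ[ℂ] ℂ}
    (hΛ : ∀ T : multiplicityModule hcpt τ P.1,
      transferMap (whittakerFunctional ν₀ (continuous_adeleAddChar K)
        (ContRepresentation.Equiv.refl P.1.toContRep)) hτ T =
        Λ₀ T • transferMap (whittakerFunctional ν₀ (continuous_adeleAddChar K)
          (ContRepresentation.Equiv.refl P.1.toContRep)) hτ T₀)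
    {ρ : ∀ v : HeightOneSpectrum (𝓞 K), Representation ℂ (GL (Fin 2) (v.adicCompletion K)) (V v)}
    {x₀ : ∀ v, V v} {j : RestrictedFamily V x₀ → multiplicityModule hcpt τ P.1}
    {lam : ∀ v, Module.Dual ℂ (V v)} {eu : ∀ v, V v}
    (hprod : ∀ (S : Finset (HeightOneSpectrum (𝓞 K))) (gf : GL (Fin 2) (FiniteAdeleRing (𝓞 K) K))
      (x : RestrictedFamily V x₀), (∀ v ∉ S, ρ v (GLn.restrictedPiEquiv 2 K gf v) (x v) = x₀ v) →
      Λ₀ (finComponentRep hcpt τ P.1 gf (j x)) =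
        Λ₀ (j (RestrictedFamily.extend S fun v : S => eu v)) *
          ∏ v ∈ S, lam v (ρ v (GLn.restrictedPiEquiv 2 K gf v) (x v)))
    (S : Finset (HeightOneSpectrum (𝓞 K))) (x : RestrictedFamily V x₀) (e : archGardingSpace hcpt τ)
    (hxS : ∀ v ∉ S, x v = x₀ v)
    (hfix : ∀ v ∉ S, x₀ v ∈ (ρ v).fixedPoints (glInt 2 (v.adicCompletion K)))
    {a : ideleGroup K} (ha : a ∈ ideleUnitBox (K := K) {w | w ∉ S}) :
    whittakerDepth 0 (invQuot (AdelicGroupData.gl 2 K)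
        (contRep (((j x : multiplicityModule hcpt τ P.1) : E →L[ℂ] (AdelicGroupData.gl 2 K).L2 μ) (e : E))))
        (glDiagonal 2 (AdeleRing (𝓞 K) K) ![a, 1]) =
      Λ₀ (j (RestrictedFamily.extend S fun v : S => eu v)) *
        (∏ v ∈ S, lam v (ρ v (diagGL2 ((GaloisRepresentations.ideleGroup.finComp (K := K) v).toHomUnits a) 1)
          (x v))) *
        kirillovFn hτ (transferMap (whittakerFunctional ν₀ (continuous_adeleAddChar K)
          (ContRepresentation.Equiv.refl P.1.toContRep)) hτ T₀) e (archUnitsOfIdele K a) := by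
  rw [whittakerDepth_zero_pureTensor_glDiagonal P hτ (by norm_num) ν₀ hΛ hprod S x e hxS hfix ![a, 1]
    (valued_vecCons_one_eq_one_of_mem_ideleUnitBox ha), kirillovFn_apply]
  have hprodS : (∏ v ∈ S, lam v (ρ v (glDiagonal 2 (v.adicCompletion K) fun i =>
      (GaloisRepresentations.ideleGroup.finComp (K := K) v).toHomUnits (![a, 1] i)) (x v))) =
      ∏ v ∈ S, lam v (ρ v (diagGL2 ((GaloisRepresentations.ideleGroup.finComp (K := K) v).toHomUnits a) 1)
        (x v)) :=
    Finset.prod_congr rfl fun v _ => by rw [glDiagonal_finComp_vecCons_one]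
  have harch : (⟨τ (toArch hcpt (glDiagonal 2 (mixedSpace K) (archTorusOfIdele 2 K ![a, 1]))) (e : E),
      apply_mem_archGardingSpace hτ _ e.2⟩ : archGardingSpace hcpt τ) =
      ⟨τ (toArch hcpt (diagGL2 (archUnitsOfIdele K a) 1)) (e : E), apply_mem_archGardingSpace hτ _ e.2⟩ := by
    apply Subtype.ext
    change τ (toArch hcpt (glDiagonal 2 (mixedSpace K) (archTorusOfIdele 2 K ![a, 1]))) (e : E) = _
    rw [glDiagonal_archTorusOfIdele_vecCons_one]
  rw [hprodS, harch]

/-- **The Hecke integrand of a pure tensor on the box**: for `a` a unit off `S`,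

  `W_φ(diag(a,1)) |a|^{s} = Λ₀(j(e_S)) · (ξ(a_∞) N(a_∞)^{s}) · ∏_{v ∈ S} λ_v(ρ_v(diag(a_v,1)) x_v) |a_v|_v^{s}`,

`ξ = kirillovFn ℓ_∞ e` (apply with `s - 1/2`). [cite: JacquetLanglands1970, §11 (11.1.2)] -/
theorem heckeIntegrand_pureTensor_of_mem_ideleUnitBox (P : CuspidalAutomorphicRepGL 2 K μ)
    (hτ : τ.IsStronglyContinuous) (ν₀ : Measure ↥(adelicUnipotent 2 K)) [IsHaarMeasure ν₀]
    {T₀ : multiplicityModule hcpt τ P.1} {Λ₀ : multiplicityModule hcpt τ P.1 →ₗ[ℂ] ℂ}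
    (hΛ : ∀ T : multiplicityModule hcpt τ P.1,
      transferMap (whittakerFunctional ν₀ (continuous_adeleAddChar K)
        (ContRepresentation.Equiv.refl P.1.toContRep)) hτ T =
        Λ₀ T • transferMap (whittakerFunctional ν₀ (continuous_adeleAddChar K)
          (ContRepresentation.Equiv.refl P.1.toContRep)) hτ T₀)
    {ρ : ∀ v : HeightOneSpectrum (𝓞 K), Representation ℂ (GL (Fin 2) (v.adicCompletion K)) (V v)}
    {x₀ : ∀ v, V v} {j : RestrictedFamily V x₀ → multiplicityModule hcpt τ P.1}
    {lam : ∀ v, Module.Dual ℂ (V v)} {eu : ∀ v, V v}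
    (hprod : ∀ (S : Finset (HeightOneSpectrum (𝓞 K))) (gf : GL (Fin 2) (FiniteAdeleRing (𝓞 K) K))
      (x : RestrictedFamily V x₀), (∀ v ∉ S, ρ v (GLn.restrictedPiEquiv 2 K gf v) (x v) = x₀ v) →
      Λ₀ (finComponentRep hcpt τ P.1 gf (j x)) =
        Λ₀ (j (RestrictedFamily.extend S fun v : S => eu v)) *
          ∏ v ∈ S, lam v (ρ v (GLn.restrictedPiEquiv 2 K gf v) (x v)))
    (S : Finset (HeightOneSpectrum (𝓞 K))) (x : RestrictedFamily V x₀) (e : archGardingSpace hcpt τ)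
    (hxS : ∀ v ∉ S, x v = x₀ v)
    (hfix : ∀ v ∉ S, x₀ v ∈ (ρ v).fixedPoints (glInt 2 (v.adicCompletion K)))
    (s : ℂ) {a : ideleGroup K} (ha : a ∈ ideleUnitBox (K := K) {w | w ∉ S}) :
    whittakerDepth 0 (invQuot (AdelicGroupData.gl 2 K)
        (contRep (((j x : multiplicityModule hcpt τ P.1) : E →L[ℂ] (AdelicGroupData.gl 2 K).L2 μ) (e : E))))
        (glDiagonal 2 (AdeleRing (𝓞 K) K) ![a, 1]) *
        ((IdeleClassGroup.ideleNorm K a : ℝ) : ℂ) ^ s =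
      Λ₀ (j (RestrictedFamily.extend S fun v : S => eu v)) *
        (kirillovFn hτ (transferMap (whittakerFunctional ν₀ (continuous_adeleAddChar K)
            (ContRepresentation.Equiv.refl P.1.toContRep)) hτ T₀) e (archUnitsOfIdele K a) *
          ((mixedEmbedding.norm ((archUnitsOfIdele K a : (mixedSpace K)ˣ) : mixedSpace K) : ℝ) : ℂ) ^ s) *
        ∏ v ∈ S, (lam v (ρ v (diagGL2 ((GaloisRepresentations.ideleGroup.finComp (K := K) v).toHomUnits a) 1)
            (x v)) *
          ((((normAbs (v.adicCompletion K)
            (((GaloisRepresentations.ideleGroup.finComp (K := K) v).toHomUnits a : (v.adicCompletion K)ˣ) :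
              v.adicCompletion K) : ℝ≥0) : ℝ) : ℂ) ^ s)) := by
  rw [whittakerDepth_zero_pureTensor_diag_of_mem_ideleUnitBox P hτ ν₀ hΛ hprod S x e hxS hfix ha,
    ideleNorm_cpow_eq_of_mem_ideleUnitBox ha s, Finset.prod_mul_distrib]
  ring

variable [MeasurableSpace (ideleGroup K)] [BorelSpace (ideleGroup K)]
  [MeasurableSpace ((mixedSpace K)ˣ)]
  [∀ v : HeightOneSpectrum (𝓞 K), MeasurableSpace ((v.adicCompletion K)ˣ)]

/-- **MAIN. The integral of the Hecke integrand of a pure tensor over the box `B(Sᶜ)`.** Let `ν` be a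
measure on `𝕀_K`, `μ_∞` a measure on `K_∞ˣ`, `μ_v` measures on `K_vˣ`, and `c ≥ 0` a constant splitting
`ν|_{B(Sᶜ)}` against `μ_∞ ⊗ ⊗_{v ∈ S} μ_v` on product integrands (hypothesis `hsplit`: the conclusion of
`exists_setIntegral_ideleUnitBox_compl_prod_eq_mul_prod` / `exists_splittingConst_ideleUnitBox_compl` for a
left-invariant `ν` finite on compacts and Haar measures `μ_∞`, `μ_v`). Then for every pure tensor `e ⊗ j(x)`
as above and every `s` at which the archimedean integrand `u ↦ ξ(u) N(u)^{s}` (`ξ = kirillovFn ℓ_∞ e`) is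
`μ_∞`-integrable and the local integrands `y ↦ λ_v(ρ_v(diag(y,1)) x_v) |y|_v^{s}`, `v ∈ S`, are `μ_v`-integrable,
the Hecke integrand is integrable on the box and

  `∫_{B(Sᶜ)} W_φ(diag(a,1)) |a|^{s} dν(a)
     = c · Λ₀(j(e_S)) · (∫ ξ(u) N(u)^{s} dμ_∞(u)) · ∏_{v ∈ S} ∫ λ_v(ρ_v(diag(y,1)) x_v) |y|_v^{s} dμ_v(y)`

(apply with `s - 1/2`): the `S`-part of the Euler factorisation `Ψ(s, φ) = ∏_v Ψ(s, W_v)` of the global Hecke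
integral of Jacquet–Langlands (1970), (11.1.2), p. 171, with honest local zeta integrals at the places of `S`.
[cite: JacquetLanglands1970, §11 (11.1.2), p. 171] [cite: CasselsFrohlichANT1967, Ch. XV §4.3] -/
theorem setIntegral_ideleUnitBox_heckeIntegrand_pureTensor (P : CuspidalAutomorphicRepGL 2 K μ)
    (hτ : τ.IsStronglyContinuous) (ν₀ : Measure ↥(adelicUnipotent 2 K)) [IsHaarMeasure ν₀]
    {T₀ : multiplicityModule hcpt τ P.1} {Λ₀ : multiplicityModule hcpt τ P.1 →ₗ[ℂ] ℂ}
    (hΛ : ∀ T : multiplicityModule hcpt τ P.1,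
      transferMap (whittakerFunctional ν₀ (continuous_adeleAddChar K)
        (ContRepresentation.Equiv.refl P.1.toContRep)) hτ T =
        Λ₀ T • transferMap (whittakerFunctional ν₀ (continuous_adeleAddChar K)
          (ContRepresentation.Equiv.refl P.1.toContRep)) hτ T₀)
    {ρ : ∀ v : HeightOneSpectrum (𝓞 K), Representation ℂ (GL (Fin 2) (v.adicCompletion K)) (V v)}
    {x₀ : ∀ v, V v} {j : RestrictedFamily V x₀ → multiplicityModule hcpt τ P.1}
    {lam : ∀ v, Module.Dual ℂ (V v)} {eu : ∀ v, V v}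
    (hprod : ∀ (S : Finset (HeightOneSpectrum (𝓞 K))) (gf : GL (Fin 2) (FiniteAdeleRing (𝓞 K) K))
      (x : RestrictedFamily V x₀), (∀ v ∉ S, ρ v (GLn.restrictedPiEquiv 2 K gf v) (x v) = x₀ v) →
      Λ₀ (finComponentRep hcpt τ P.1 gf (j x)) =
        Λ₀ (j (RestrictedFamily.extend S fun v : S => eu v)) *
          ∏ v ∈ S, lam v (ρ v (GLn.restrictedPiEquiv 2 K gf v) (x v)))
    (S : Finset (HeightOneSpectrum (𝓞 K))) (x : RestrictedFamily V x₀) (e : archGardingSpace hcpt τ)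
    (hxS : ∀ v ∉ S, x v = x₀ v)
    (hfix : ∀ v ∉ S, x₀ v ∈ (ρ v).fixedPoints (glInt 2 (v.adicCompletion K)))
    (ν : Measure (ideleGroup K)) (μinf : Measure (mixedSpace K)ˣ)
    (μv : ∀ v : HeightOneSpectrum (𝓞 K), Measure (v.adicCompletion K)ˣ) {c : ℝ≥0}
    (hsplit : ∀ (g : (mixedSpace K)ˣ → ℂ) (h : ∀ v : ↥S, (v.1.adicCompletion K)ˣ → ℂ),
      Integrable g μinf → (∀ v, Integrable (h v) (μv v.1)) →
      IntegrableOn (fun a : ideleGroup K => g (archUnitsOfIdele K a) *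
          ∏ v : ↥S, h v ((GaloisRepresentations.ideleGroup.finComp v.1).toHomUnits a))
        (ideleUnitBox (K := K) {w | w ∉ S}) ν ∧
      ∫ a in ideleUnitBox (K := K) {w | w ∉ S}, g (archUnitsOfIdele K a) *
          ∏ v : ↥S, h v ((GaloisRepresentations.ideleGroup.finComp v.1).toHomUnits a) ∂ν =
        (c : ℂ) * (∫ x, g x ∂μinf) * ∏ v : ↥S, ∫ y, h v y ∂(μv v.1))
    (s : ℂ)
    (hgi : Integrable (fun u : (mixedSpace K)ˣ =>
      kirillovFn hτ (transferMap (whittakerFunctional ν₀ (continuous_adeleAddChar K)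
          (ContRepresentation.Equiv.refl P.1.toContRep)) hτ T₀) e u *
        ((mixedEmbedding.norm ((u : (mixedSpace K)ˣ) : mixedSpace K) : ℝ) : ℂ) ^ s) μinf)
    (hhi : ∀ v ∈ S, Integrable (fun y : (v.adicCompletion K)ˣ =>
      lam v (ρ v (diagGL2 y 1) (x v)) *
        (((normAbs (v.adicCompletion K) (y : v.adicCompletion K) : ℝ≥0) : ℝ) : ℂ) ^ s) (μv v)) :
    IntegrableOn (fun a : ideleGroup K =>
        whittakerDepth 0 (invQuot (AdelicGroupData.gl 2 K)
          (contRep (((j x : multiplicityModule hcpt τ P.1) : E →L[ℂ] (AdelicGroupData.gl 2 K).L2 μ) (e : E))))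
          (glDiagonal 2 (AdeleRing (𝓞 K) K) ![a, 1]) *
        ((IdeleClassGroup.ideleNorm K a : ℝ) : ℂ) ^ s) (ideleUnitBox (K := K) {w | w ∉ S}) ν ∧
    ∫ a in ideleUnitBox (K := K) {w | w ∉ S},
        whittakerDepth 0 (invQuot (AdelicGroupData.gl 2 K)
          (contRep (((j x : multiplicityModule hcpt τ P.1) : E →L[ℂ] (AdelicGroupData.gl 2 K).L2 μ) (e : E))))
          (glDiagonal 2 (AdeleRing (𝓞 K) K) ![a, 1]) *
        ((IdeleClassGroup.ideleNorm K a : ℝ) : ℂ) ^ s ∂ν =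
      (c : ℂ) * Λ₀ (j (RestrictedFamily.extend S fun v : S => eu v)) *
        (∫ u : (mixedSpace K)ˣ, kirillovFn hτ (transferMap (whittakerFunctional ν₀ (continuous_adeleAddChar K)
            (ContRepresentation.Equiv.refl P.1.toContRep)) hτ T₀) e u *
          ((mixedEmbedding.norm ((u : (mixedSpace K)ˣ) : mixedSpace K) : ℝ) : ℂ) ^ s ∂μinf) *
        ∏ v ∈ S, ∫ y : (v.adicCompletion K)ˣ, lam v (ρ v (diagGL2 y 1) (x v)) *
          (((normAbs (v.adicCompletion K) (y : v.adicCompletion K) : ℝ≥0) : ℝ) : ℂ) ^ s ∂(μv v) := by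
  -- the archimedean and local integrands
  set g : (mixedSpace K)ˣ → ℂ := fun u =>
    kirillovFn hτ (transferMap (whittakerFunctional ν₀ (continuous_adeleAddChar K)
        (ContRepresentation.Equiv.refl P.1.toContRep)) hτ T₀) e u *
      ((mixedEmbedding.norm ((u : (mixedSpace K)ˣ) : mixedSpace K) : ℝ) : ℂ) ^ s with hg
  set h : ∀ v : ↥S, (v.1.adicCompletion K)ˣ → ℂ := fun v y =>
    lam v.1 (ρ v.1 (diagGL2 y 1) (x v.1)) *
      (((normAbs (v.1.adicCompletion K) (y : v.1.adicCompletion K) : ℝ≥0) : ℝ) : ℂ) ^ s with hh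
  obtain ⟨hint, hval⟩ := hsplit g h hgi (fun v => hhi v.1 v.2)
  -- the integrand on the box is `Λ₀(j(e_S)) · g(a_∞) · ∏_{v ∈ S} h_v(a_v)`
  have hpt : ∀ a ∈ ideleUnitBox (K := K) {w | w ∉ S},
      whittakerDepth 0 (invQuot (AdelicGroupData.gl 2 K)
          (contRep (((j x : multiplicityModule hcpt τ P.1) : E →L[ℂ] (AdelicGroupData.gl 2 K).L2 μ) (e : E))))
          (glDiagonal 2 (AdeleRing (𝓞 K) K) ![a, 1]) *
        ((IdeleClassGroup.ideleNorm K a : ℝ) : ℂ) ^ s =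
      Λ₀ (j (RestrictedFamily.extend S fun v : S => eu v)) *
        (g (archUnitsOfIdele K a) *
          ∏ v : ↥S, h v ((GaloisRepresentations.ideleGroup.finComp (K := K) v.1).toHomUnits a)) := by
    intro a ha
    rw [heckeIntegrand_pureTensor_of_mem_ideleUnitBox P hτ ν₀ hΛ hprod S x e hxS hfix s ha,
      ← Finset.prod_coe_sort S]
    simp only [hg, hh]
    ring
  obtain ⟨ϖ, hϖ⟩ : ∃ ϖ : ∀ v : HeightOneSpectrum (𝓞 K), (v.adicCompletion K)ˣ,
      ∀ v, Valued.v ((ϖ v : (v.adicCompletion K)ˣ) : v.adicCompletion K) = WithZero.exp (-1 : ℤ) :=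
    ⟨fun v => GaloisRepresentations.HeckeCharacter.uniformizer K v, fun v => GaloisRepresentations.HeckeCharacter.valued_uniformizer v⟩
  have hBm : MeasurableSet (ideleUnitBox (K := K) {w | w ∉ S}) := measurableSet_ideleUnitBox_compl ϖ hϖ S
  refine ⟨?_, ?_⟩
  · -- integrability: the integrand agrees on the box with `Λ₀(j(e_S)) · (g(a_∞) ∏ h_v(a_v))`
    have h2 : IntegrableOn (fun a : ideleGroup K => Λ₀ (j (RestrictedFamily.extend S fun v : S => eu v)) *
        (g (archUnitsOfIdele K a) *
          ∏ v : ↥S, h v ((GaloisRepresentations.ideleGroup.finComp (K := K) v.1).toHomUnits a)))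
        (ideleUnitBox (K := K) {w | w ∉ S}) ν := hint.const_mul _
    exact h2.congr_fun (fun a ha => (hpt a ha).symm) hBm
  · rw [setIntegral_congr_fun hBm hpt, integral_const_mul, hval]
    have hprodS : (∏ v : ↥S, ∫ y, h v y ∂(μv v.1)) =
        ∏ v ∈ S, ∫ y : (v.adicCompletion K)ˣ, lam v (ρ v (diagGL2 y 1) (x v)) *
          (((normAbs (v.adicCompletion K) (y : v.adicCompletion K) : ℝ≥0) : ℝ) : ℂ) ^ s ∂(μv v) := by
      rw [← Finset.prod_coe_sort S]
    rw [hprodS]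
    ring

end Box

end Literature.NumberTheory.Automorphic
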